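import Mathlib
import Summits.NavierStokesRegularity.NavierStokesRegularity.Theorems.WakeRatchetTailRatchetScalarFrontPositive
import HarnessLib

/-!
# Scalar dyadic fronts (construction `DyadicScalarFronts`, stmt-NavierStokesRegularity-21808):
# the AUTONOMOUS AMPLITUDE LAW `|t|·g' = −g + Λ g(·/s)² − Λ⁻¹ g·g(s·)` for `g = |t|·a`, rung bounds,
# and small values in the past

Support file for the crux `WakeRatchet.TailRatchet` (stmt-21808; refuted BY NAME modulo the construction
`WakeRatchetDyadicFront.DyadicScalarFronts`, p589335; MODEL lattice ODEs of Tao 2016 §1.2, §4 — nothing here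
concerns the Navier–Stokes equations, and no item is closed).  Toolkit for the companion file
`…ScalarFrontNoSlow` (census item G2 of programme R-glob: the hop ratio `s` stays away from `1`).

For a profile `a` of `a' = (Λ/s²)a(t/s)² − (s/Λ)a(t)a(st)` on `t < 0` the renormalised amplitude
`g(t) = |t|·a(t) = −t·a(t)` (the DSS profile of the dictionary wave read in the time variable) obeys the
AUTONOMOUS delay law
  `|t|·g'(t) = −g(t) + Λ·g(t/s)² − Λ⁻¹·g(t)·g(st)`   (`hasDerivAt_amp`, `amp_law`);
its local part `−g + (Λ − Λ⁻¹)g²` is logistic with unstable equilibrium `F⋆ = 1/(Λ − Λ⁻¹)`, the constant of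
the tree's amplitude floor.  Consequences proved here:
* `abs_mul_deriv_amp_le` — a type-I bound `|t|·|a(t)| ≤ m` gives the log-Lipschitz bound
  `|t|·|g'(t)| ≤ K := m + Λm² + m²/Λ`;
* `rung_up`, `rung_down` — across one rung the amplitude moves by at most `K(s − 1)`:
  `|g(t/s) − g(t)| ≤ K(s−1)`, `|g(st) − g(t)| ≤ K(s−1)` (mean value inequality on `[t, t/s]`, `[st, t]`);
* `exists_amp_lt` — a positive integrable profile takes values `g < θ` before any given time, for every
  `θ > 0` (else `a ≥ θ/|t|` on a half-line, and `∫ θ/|t| = θ·log` diverges).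

HONEST FRAMING: elementary real analysis about a MODEL lattice ODE; existence of fronts is NOT proved; nothing
about Navier–Stokes.
-/

noncomputable section

set_option linter.dupNamespace false

namespace Summit.NavierStokesRegularity.NavierStokesRegularity.Theorems

namespace WakeRatchetScalarFrontAmplitude

open Filter Topology Set MeasureTheory intervalIntegral
open Literature.Analysis.FluidPDE Literature.Analysis.FluidPDE.TaoCascade
open WakeRatchetScalarFrontWake WakeRatchetScalarFrontPositive

variable {ε₀ s : ℝ} {a : ℝ → ℝ}

/-! ## The renormalised amplitude `g(t) = |t|·a(t)` and its autonomous delay law -/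

/-- Product rule for the renormalised amplitude `g(t) = −t·a(t)` along the front equation. [elementary] -/
theorem hasDerivAt_amp
    (hode : ∀ t : ℝ, t < 0 → HasDerivAt a
      (bigLam ε₀ / s ^ 2 * a (t / s) ^ 2 - s / bigLam ε₀ * a t * a (s * t)) t)
    {t : ℝ} (ht : t < 0) :
    HasDerivAt (fun u => -u * a u)
      (-a t - t * (bigLam ε₀ / s ^ 2 * a (t / s) ^ 2 - s / bigLam ε₀ * a t * a (s * t))) t := by
  have h1 : HasDerivAt (fun u : ℝ => -u) (-1) t := (hasDerivAt_id t).neg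
  refine (h1.mul (hode t ht)).congr_deriv ?_
  ring

/-- **The amplitude law.**  `|t|·g'(t) = −g(t) + Λ g(t/s)² − Λ⁻¹ g(t) g(st)` with `g(u) = −u·a(u)`
(`s ≠ 0`, `Λ ≠ 0`). [cite: Tao2016AveragedNS, §1.2 (dyadic model), §4 Lemma 4.1 (4.8) in self-similar variables; elementary] -/
theorem amp_law (hs : s ≠ 0) (hΛ : bigLam ε₀ ≠ 0) (t : ℝ) :
    (-t) * (-a t - t * (bigLam ε₀ / s ^ 2 * a (t / s) ^ 2 - s / bigLam ε₀ * a t * a (s * t)))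
      = -(-t * a t) + bigLam ε₀ * (-(t / s) * a (t / s)) ^ 2
        - (bigLam ε₀)⁻¹ * (-t * a t) * (-(s * t) * a (s * t)) := by
  field_simp
  ring

/-- A type-I bound `|t|·|a(t)| ≤ m` bounds the renormalised amplitude: `|−u·a(u)| ≤ m` for `u < 0`.
[elementary] -/
theorem abs_amp_le {m : ℝ} (hM : ∀ t : ℝ, t < 0 → |t| * |a t| ≤ m) {u : ℝ} (hu : u < 0) :
    |-u * a u| ≤ m := by
  have h := hM u hu
  rwa [abs_mul, abs_neg]

/-- **Log-Lipschitz bound.**  Under `|t|·|a(t)| ≤ m` on `t < 0`: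
`|t|·|g'(t)| ≤ K := m + Λm² + m²/Λ` for every `t < 0`. [elementary] -/
theorem abs_mul_deriv_amp_le (hε : 0 < ε₀) (hs : 1 < s) {m : ℝ}
    (hM : ∀ t : ℝ, t < 0 → |t| * |a t| ≤ m) {t : ℝ} (ht : t < 0) :
    |(-t) * (-a t - t * (bigLam ε₀ / s ^ 2 * a (t / s) ^ 2 - s / bigLam ε₀ * a t * a (s * t)))|
      ≤ m + bigLam ε₀ * m ^ 2 + m ^ 2 / bigLam ε₀ := by
  have hs0 : 0 < s := by linarith
  have hΛ : 0 < bigLam ε₀ := bigLam_pos (by linarith)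
  have hm0 : 0 ≤ m := le_trans (by positivity) (hM t ht)
  rw [amp_law hs0.ne' hΛ.ne']
  have h0 := abs_amp_le hM ht
  have h1 := abs_amp_le hM (div_neg_of_neg_of_pos ht hs0)
  have h2 := abs_amp_le hM (mul_neg_of_pos_of_neg hs0 ht)
  have hsq : (-(t / s) * a (t / s)) ^ 2 ≤ m ^ 2 := by
    rw [← sq_abs]; exact pow_le_pow_left₀ (abs_nonneg _) h1 2
  have hprod : |(-t * a t) * (-(s * t) * a (s * t))| ≤ m * m := by
    rw [abs_mul]; exact mul_le_mul h0 h2 (abs_nonneg _) hm0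
  calc |-(-t * a t) + bigLam ε₀ * (-(t / s) * a (t / s)) ^ 2
        - (bigLam ε₀)⁻¹ * (-t * a t) * (-(s * t) * a (s * t))|
      ≤ |-(-t * a t)| + |bigLam ε₀ * (-(t / s) * a (t / s)) ^ 2|
        + |(bigLam ε₀)⁻¹ * (-t * a t) * (-(s * t) * a (s * t))| := by
          have h₁ := abs_sub (-(-t * a t) + bigLam ε₀ * (-(t / s) * a (t / s)) ^ 2)
            ((bigLam ε₀)⁻¹ * (-t * a t) * (-(s * t) * a (s * t)))
          have h₂ := abs_add_le (-(-t * a t)) (bigLam ε₀ * (-(t / s) * a (t / s)) ^ 2)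
          linarith
    _ ≤ m + bigLam ε₀ * m ^ 2 + m ^ 2 / bigLam ε₀ := by
        have e1 : |-(-t * a t)| ≤ m := by rw [abs_neg]; exact h0
        have e2 : |bigLam ε₀ * (-(t / s) * a (t / s)) ^ 2| ≤ bigLam ε₀ * m ^ 2 := by
          rw [abs_mul, abs_of_pos hΛ, abs_of_nonneg (sq_nonneg _)]
          exact mul_le_mul_of_nonneg_left hsq hΛ.le
        have e3 : |(bigLam ε₀)⁻¹ * (-t * a t) * (-(s * t) * a (s * t))| ≤ m ^ 2 / bigLam ε₀ := by
          rw [mul_assoc, abs_mul, abs_of_pos (inv_pos.2 hΛ), div_eq_inv_mul, sq]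
          exact mul_le_mul_of_nonneg_left hprod (inv_pos.2 hΛ).le
        linarith

/-! ## One rung moves the amplitude by at most `K(s − 1)` -/

/-- **Rung bound, inwards**: `|g(t/s) − g(t)| ≤ K(s−1)` for `t < 0` (mean value inequality on `[t, t/s]`,
where `|g'| ≤ Ks/|t|`). [elementary] -/
theorem rung_up (hε : 0 < ε₀) (hs : 1 < s)
    (hode : ∀ t : ℝ, t < 0 → HasDerivAt a
      (bigLam ε₀ / s ^ 2 * a (t / s) ^ 2 - s / bigLam ε₀ * a t * a (s * t)) t)
    {m : ℝ} (hM : ∀ t : ℝ, t < 0 → |t| * |a t| ≤ m) {t : ℝ} (ht : t < 0) :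
    |-(t / s) * a (t / s) - -t * a t| ≤ (m + bigLam ε₀ * m ^ 2 + m ^ 2 / bigLam ε₀) * (s - 1) := by
  have hs0 : 0 < s := by linarith
  have hK0 : 0 ≤ m + bigLam ε₀ * m ^ 2 + m ^ 2 / bigLam ε₀ :=
    le_trans (abs_nonneg _) (abs_mul_deriv_amp_le hε hs hM ht)
  set K : ℝ := m + bigLam ε₀ * m ^ 2 + m ^ 2 / bigLam ε₀ with hK
  have hts : t < t / s := by
    rw [lt_div_iff₀ hs0]; nlinarith
  have hts0 : t / s < 0 := div_neg_of_neg_of_pos ht hs0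
  have hseg : ∀ u ∈ Icc t (t / s), HasDerivWithinAt (fun u => -u * a u)
      (-a u - u * (bigLam ε₀ / s ^ 2 * a (u / s) ^ 2 - s / bigLam ε₀ * a u * a (s * u))) (Icc t (t / s)) u :=
    fun u hu => (hasDerivAt_amp hode (lt_of_le_of_lt hu.2 hts0)).hasDerivWithinAt
  have hbound : ∀ u ∈ Icc t (t / s),
      ‖-a u - u * (bigLam ε₀ / s ^ 2 * a (u / s) ^ 2 - s / bigLam ε₀ * a u * a (s * u))‖ ≤ K * s / (-t) := by
    intro u hu
    have hu0 : u < 0 := lt_of_le_of_lt hu.2 hts0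
    have hnu0 : 0 < -u := by linarith
    have hnu : -t ≤ s * (-u) := by
      have h2 : u ≤ t / s := hu.2
      rw [le_div_iff₀ hs0] at h2
      linarith
    have h := abs_mul_deriv_amp_le hε hs hM hu0
    rw [abs_mul, abs_of_pos hnu0, ← hK] at h
    rw [Real.norm_eq_abs, le_div_iff₀ (by linarith : (0:ℝ) < -t)]
    calc _ ≤ |-a u - u * (bigLam ε₀ / s ^ 2 * a (u / s) ^ 2 - s / bigLam ε₀ * a u * a (s * u))| * (s * (-u)) :=
          mul_le_mul_of_nonneg_left hnu (abs_nonneg _)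
      _ = s * ((-u) * |-a u - u * (bigLam ε₀ / s ^ 2 * a (u / s) ^ 2 - s / bigLam ε₀ * a u * a (s * u))|) := by
          ring
      _ ≤ s * K := mul_le_mul_of_nonneg_left h hs0.le
      _ = K * s := by ring
  have hmv := Convex.norm_image_sub_le_of_norm_hasDerivWithin_le
    (f' := fun u => -a u - u * (bigLam ε₀ / s ^ 2 * a (u / s) ^ 2 - s / bigLam ε₀ * a u * a (s * u)))
    hseg hbound (convex_Icc _ _) (left_mem_Icc.2 hts.le) (right_mem_Icc.2 hts.le)
  simp only [Real.norm_eq_abs] at hmv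
  have hdist : |t / s - t| = (-t) * (s - 1) / s := by
    rw [abs_of_pos (by linarith)]
    field_simp
    ring
  rw [hdist] at hmv
  have ht0' : t ≠ 0 := ht.ne
  have he : K * s / -t * (-t * (s - 1) / s) = K * (s - 1) := by
    field_simp
  linarith [hmv, he.symm.le, he.le]

/-- **Rung bound, outwards**: `|g(st) − g(t)| ≤ K(s−1)` for `t < 0` (mean value inequality on `[st, t]`,
where `|g'| ≤ K/|t|`). [elementary] -/
theorem rung_down (hε : 0 < ε₀) (hs : 1 < s)
    (hode : ∀ t : ℝ, t < 0 → HasDerivAt a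
      (bigLam ε₀ / s ^ 2 * a (t / s) ^ 2 - s / bigLam ε₀ * a t * a (s * t)) t)
    {m : ℝ} (hM : ∀ t : ℝ, t < 0 → |t| * |a t| ≤ m) {t : ℝ} (ht : t < 0) :
    |-(s * t) * a (s * t) - -t * a t| ≤ (m + bigLam ε₀ * m ^ 2 + m ^ 2 / bigLam ε₀) * (s - 1) := by
  have hs0 : 0 < s := by linarith
  have hK0 : 0 ≤ m + bigLam ε₀ * m ^ 2 + m ^ 2 / bigLam ε₀ :=
    le_trans (abs_nonneg _) (abs_mul_deriv_amp_le hε hs hM ht)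
  set K : ℝ := m + bigLam ε₀ * m ^ 2 + m ^ 2 / bigLam ε₀ with hK
  have hst : s * t < t := by nlinarith
  have hseg : ∀ u ∈ Icc (s * t) t, HasDerivWithinAt (fun u => -u * a u)
      (-a u - u * (bigLam ε₀ / s ^ 2 * a (u / s) ^ 2 - s / bigLam ε₀ * a u * a (s * u))) (Icc (s * t) t) u :=
    fun u hu => (hasDerivAt_amp hode (lt_of_le_of_lt hu.2 ht)).hasDerivWithinAt
  have hbound : ∀ u ∈ Icc (s * t) t,
      ‖-a u - u * (bigLam ε₀ / s ^ 2 * a (u / s) ^ 2 - s / bigLam ε₀ * a u * a (s * u))‖ ≤ K / (-t) := by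
    intro u hu
    have hu0 : u < 0 := lt_of_le_of_lt hu.2 ht
    have hnu0 : 0 < -u := by linarith
    have hnu : -t ≤ -u := by linarith [hu.2]
    have h := abs_mul_deriv_amp_le hε hs hM hu0
    rw [abs_mul, abs_of_pos hnu0, ← hK] at h
    rw [Real.norm_eq_abs, le_div_iff₀ (by linarith : (0:ℝ) < -t)]
    calc _ ≤ |-a u - u * (bigLam ε₀ / s ^ 2 * a (u / s) ^ 2 - s / bigLam ε₀ * a u * a (s * u))| * (-u) :=
          mul_le_mul_of_nonneg_left hnu (abs_nonneg _)
      _ = (-u) * |-a u - u * (bigLam ε₀ / s ^ 2 * a (u / s) ^ 2 - s / bigLam ε₀ * a u * a (s * u))| := by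
          ring
      _ ≤ K := h
  have hmv := Convex.norm_image_sub_le_of_norm_hasDerivWithin_le
    (f' := fun u => -a u - u * (bigLam ε₀ / s ^ 2 * a (u / s) ^ 2 - s / bigLam ε₀ * a u * a (s * u)))
    hseg hbound (convex_Icc _ _) (right_mem_Icc.2 hst.le) (left_mem_Icc.2 hst.le)
  simp only [Real.norm_eq_abs] at hmv
  have hdist : |s * t - t| = (-t) * (s - 1) := by
    rw [abs_of_neg (by nlinarith)]
    ring
  rw [hdist] at hmv
  have ht0' : t ≠ 0 := ht.ne
  have he : K / -t * (-t * (s - 1)) = K * (s - 1) := by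
    field_simp
  linarith [hmv, he.symm.le, he.le]

/-! ## Integrability puts the profile below any level far out -/

/-- **Small values in the past.**  A positive profile that is integrable on `(−∞,0)` falls below any level
`θ > 0` of the renormalised amplitude before any given time: for `t_a < 0` there is `t_b < t_a` with
`|t_b|·a(t_b) < θ` (otherwise `a ≥ θ/|t|` on `(−∞, t_a)`, and `∫_{t_a e^{(A+1)/θ}}^{t_a} θ/|t| dt = A + 1`
exceeds `A = ∫_{t<0} a`). [elementary] -/
theorem exists_amp_lt (hint : IntegrableOn a (Iio 0)) (hpos : ∀ t : ℝ, t < 0 → 0 < a t)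
    {θ : ℝ} (hθ : 0 < θ) {ta : ℝ} (hta : ta < 0) :
    ∃ tb : ℝ, tb < ta ∧ -tb * a tb < θ := by
  by_contra hcon
  push Not at hcon
  set A : ℝ := ∫ u in Iio 0, a u with hA
  have hA0 : 0 ≤ A := setIntegral_nonneg measurableSet_Iio fun u hu => (hpos u hu).le
  have hq : 0 < (A + 1) / θ := by positivity
  set T : ℝ := ta * Real.exp ((A + 1) / θ) with hT
  have hexp1 : 1 < Real.exp ((A + 1) / θ) := by
    have := Real.add_one_lt_exp hq.ne'
    linarith
  have hTlt : T < ta := by rw [hT]; nlinarith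
  have hT0 : T < 0 := hTlt.trans hta
  have h0notin : (0 : ℝ) ∉ uIcc T ta := by
    rw [uIcc_of_le hTlt.le]; intro h0; linarith [h0.2]
  -- interval integrability of both sides on `[T, ta]`
  have hIa : IntervalIntegrable a volume T ta := by
    rw [intervalIntegrable_iff_integrableOn_Ioc_of_le hTlt.le]
    exact hint.mono_set fun u hu => lt_of_le_of_lt hu.2 hta
  have hIinv : IntervalIntegrable (fun u : ℝ => -θ * u⁻¹) volume T ta :=
    (intervalIntegrable_inv_iff.2 (Or.inr h0notin)).const_mul (-θ)
  have hmono : ∫ u in T..ta, -θ * u⁻¹ ≤ ∫ u in T..ta, a u := by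
    refine intervalIntegral.integral_mono_on_of_le_Ioo hTlt.le hIinv hIa fun u hu => ?_
    have hu0 : u < 0 := hu.2.trans hta
    have hnu : 0 < -u := by linarith
    have h := hcon u hu.2
    have e : -θ * u⁻¹ = θ / (-u) := by
      field_simp
    rw [e, div_le_iff₀ hnu]
    linarith
  -- the left integral is `A + 1`
  have hleft : ∫ u in T..ta, -θ * u⁻¹ = A + 1 := by
    rw [intervalIntegral.integral_const_mul, integral_inv h0notin]
    have e : ta / T = Real.exp (-((A + 1) / θ)) := by
      rw [Real.exp_neg, hT, div_mul_eq_div_div, div_self hta.ne, one_div]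
    rw [e, Real.log_exp]
    field_simp
  -- the right integral is at most `A`
  have hright : ∫ u in T..ta, a u ≤ A := by
    rw [intervalIntegral.integral_of_le hTlt.le]
    have hsub : (Ioc T ta : Set ℝ) ≤ Iio 0 := fun u hu => lt_of_le_of_lt hu.2 hta
    exact setIntegral_mono_set hint
      ((ae_restrict_iff' measurableSet_Iio).2 (Eventually.of_forall fun u hu => (hpos u hu).le))
      hsub.eventuallyLE
  linarith

end WakeRatchetScalarFrontAmplitude

end Summit.NavierStokesRegularity.NavierStokesRegularity.Theorems

end
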